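import Summits.Ventures.HSemireg.HomComplexTwist
import Summits.Ventures.HSemireg.UntwistCocycleTwistDualHomTrace
import Summits.Ventures.HSemireg.UntwistCocycleTwistDualHomNaturalityLeft
import HarnessLib

/-!
# Venture HSemireg — route R1.0, complex carriers: the twist `𝓗om•(K, –) ⟶ 𝓗om•(K ⊗ M, – ⊗ M)` preserves the
# UNIT and the SUPERTRACE (gs-g4 gen 22, brick C7b (ii) of `general-structure/COMPLEX-LEIBNIZ-PLAN-gs-g4.md`)

HONEST FRAMING. Homological algebra on the tree's REAL carriers (t-7/p3's `HomComplex.unit`, `HomComplex.supertrace`,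
th-4's cocycle twist and `sheafHomTwist`, gs-g4 g19's comparison `λ_G = dualHomTwist` with its contraction
compatibility `sheafHomTwist_dualHomTwist_contract`). Nothing about any variety; nothing here says HC, HC_CM or HC_AV
is proved.

## Statements (everything proved; `namespace Summit.Ventures.HSemireg.HomComplex`)

* `lamG c G K : (K ⊗ G) ⊗ M ⟶ (K ⊗ M) ⊗ G` (termwise `λ_G = dualHomTwist c (K^i) G`; a chain map).
* **`unit_twist`**: `unit(K ⊗ M) = unit(K) ≫ twistApp c K K` — the twist map sends `Σ_p 𝟙_{K^p}` to `Σ_p 𝟙_{K^p ⊗ M}`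
  (th-4 `sheafHomUnit_comp_sheafHomTwist` summandwise).
* **`twistApp_comp_map_lamG_comp_supertrace`**:
  `twistApp c K (K ⊗ G) ≫ 𝓗om•(K ⊗ M, λ•_G) ≫ Tr•_{K ⊗ M} = Tr•_K : 𝓗om•(K, K ⊗ G) ⟶ G[0]` — the supertraces agree
  through the twist (gs-g4 g19 `sheafHomTwist_dualHomTwist_contract` summandwise; the signs `(-1)^p` match).

## References

* R.-O. Buchweitz, H. Flenner, Compositio Math. 137 (2003), §4 (trace maps). [BuchweitzFlenner2003]
* R. Hartshorne, *Algebraic Geometry* (1977), II Ex. 5.1 (b). [Hartshorne1977]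
-/

noncomputable section

set_option backward.isDefEq.respectTransparency false

open CategoryTheory CategoryTheory.Limits AlgebraicGeometry Opposite

namespace Summit.Ventures.HSemireg

namespace HomComplex

open Literature.AlgebraicGeometry.Modules Literature.AlgebraicGeometry.Motives CocycleTwist
  Summit.HodgeConjecture.HodgeConjecture.Theorems.PadicPridhamSemiregularity

universe u

variable {S : Type u} [CommRing S] {X : Over (Spec (CommRingCat.of S))} (c : UnitCocycle X.left) (G : X.left.Modules)
  (K : CochainComplex X.left.Modules ℤ)

/-! ### `λ•_G : (K ⊗ G) ⊗ M ⟶ (K ⊗ M) ⊗ G` -/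

/-- **`λ•_G`**: termwise gs-g4 g19's comparison `λ_G = dualHomTwist c (Kⁱ) G`; a chain map by naturality of `λ` in the
module (`twistMap_twistMap_comp_dualHomTwist`). [cite: Hartshorne1977, II Ex. 5.1 (b)] -/
def lamG : (prolong c).obj (twistG X.left G K) ⟶ twistG X.left G ((prolong c).obj K) where
  f i := dualHomTwist c (K.X i) G
  comm' i i' _ := by
    change dualHomTwist c (K.X i) G ≫
        Summit.HodgeConjecture.HodgeConjecture.Theorems.PadicPridhamSemiregularity.twistMap
          (CocycleTwist.twistMap c (K.d i i')) G =
      CocycleTwist.twistMap c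
        (Summit.HodgeConjecture.HodgeConjecture.Theorems.PadicPridhamSemiregularity.twistMap (K.d i i') G) ≫
          dualHomTwist c (K.X i') G
    exact (twistMap_twistMap_comp_dualHomTwist c G (K.d i i')).symm

/-- Components of `λ•_G`. [folklore] -/
@[simp]
theorem lamG_f (i : ℤ) : (lamG c G K).f i = dualHomTwist c (K.X i) G := rfl

/-! ### The twist preserves the unit -/

section Unit

variable (a b : ℤ) [K.IsStrictlyGE a] [K.IsStrictlyLE b]

/-- `K ⊗ M` is concentrated where `K` is (lower bound). [folklore] -/
instance prolong_isStrictlyGE : ((prolong c).obj K).IsStrictlyGE a :=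
  inferInstanceAs (HomologicalComplex.IsStrictlySupported _ _)

/-- `K ⊗ M` is concentrated where `K` is (upper bound). [folklore] -/
instance prolong_isStrictlyLE : ((prolong c).obj K).IsStrictlyLE b :=
  inferInstanceAs (HomologicalComplex.IsStrictlySupported _ _)

/-- On each summand: `(a ↦ a · 𝟙_{K^{-i}}) ≫ ι ≫ twist = (a ↦ a · 𝟙_{K^{-i} ⊗ M}) ≫ ι`. [folklore] -/
theorem unitSummand_comp_twistAppX (i : ℤ) :
    unitSummand X.left K i ≫ twistAppX c K K 0 = unitSummand X.left ((prolong c).obj K) i := by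
  dsimp only [unitSummand]
  rw [Category.assoc, ι_twistAppX, ← Category.assoc, sheafHomUnit_comp_sheafHomTwist]
  rfl

/-- **The twist preserves the unit**: `unit(K) ≫ (𝓗om•(K, K) ⟶ 𝓗om•(K ⊗ M, K ⊗ M)) = unit(K ⊗ M)`. [folklore] -/
theorem unit_twist : unit X.left K a b ≫ twistApp c K K = unit X.left ((prolong c).obj K) a b := by
  refine HomologicalComplex.from_single_hom_ext ?_
  rw [HomologicalComplex.comp_f, unit, unit, HomologicalComplex.mkHomFromSingle_f, HomologicalComplex.mkHomFromSingle_f,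
    Category.assoc, twistApp_f, unitDeg₀, unitDeg₀, Preadditive.sum_comp]
  exact congrArg _ (Finset.sum_congr rfl fun i _ => unitSummand_comp_twistAppX c K i)

end Unit

/-! ### The twist preserves the supertrace -/

section Supertrace

/-- `K ⊗ M` is termwise finite locally free if `K` is. [folklore] -/
theorem isFiniteLocallyFree_prolong_X (hK : ∀ n, IsFiniteLocallyFree (K.X n)) (n : ℤ) :
    IsFiniteLocallyFree (((prolong c).obj K).X n) :=
  isFiniteLocallyFree_twist c (hK n)

variable (hK : ∀ n, IsFiniteLocallyFree (K.X n))

/-- On each summand of degree `0`: `γ ≫ 𝓗om(K^{-i} ⊗ M, λ) ≫ (-1)^i str_{K^{-i} ⊗ M} = (-1)^i str_{K^{-i}}`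
(gs-g4 g19 `sheafHomTwist_dualHomTwist_contract`). [cite: BuchweitzFlenner2003, §4] -/
theorem sheafHomTwist_comp_strComp (q i : ℤ) (h : q + i = 0) :
    sheafHomTwist c (K.X (-i)) ((twistG X.left G K).X q) ≫
        sheafHomMap (twist c (K.X (-i))) ((lamG c G K).f q) ≫
          strComp X.left G ((prolong c).obj K) (isFiniteLocallyFree_prolong_X c K hK) q i h =
      strComp X.left G K hK q i h := by
  obtain rfl : q = -i := by omega
  rw [strComp, strComp, HomologicalComplex.XIsoOfEq_rfl, HomologicalComplex.XIsoOfEq_rfl, Iso.refl_hom, Iso.refl_hom,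
    sheafHomMap_id, sheafHomMap_id, Category.id_comp, Category.id_comp, Linear.comp_units_smul, Linear.comp_units_smul,
    lamG_f]
  exact congrArg _ (sheafHomTwist_dualHomTwist_contract c (K.X (-i)) G (hK (-i)))

/-- Degree `0`: `twist ≫ 𝓗om•(K ⊗ M, λ•)^0 ≫ str₀(K ⊗ M) = str₀(K)`. [folklore] -/
theorem twistAppX_comp_map_lamG_comp_str₀ :
    twistAppX c K (twistG X.left G K) 0 ≫ (map X.left ((prolong c).obj K) (lamG c G K)).f 0 ≫
        str₀ X.left G ((prolong c).obj K) (isFiniteLocallyFree_prolong_X c K hK) =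
      str₀ X.left G K hK := by
  refine HomologicalComplex.mapBifunctor.hom_ext fun q i (h : q + i = 0) => ?_
  change ι X.left K (twistG X.left G K) q i 0 h ≫ _ = ι X.left K (twistG X.left G K) q i 0 h ≫ _
  rw [ι_twistAppX_assoc, reassoc_of% (ι_map X.left ((prolong c).obj K) (lamG c G K) q i 0 h), ι_str₀, ι_str₀]
  exact sheafHomTwist_comp_strComp c G K hK q i h

/-- **The twist preserves the supertrace**:
`(𝓗om•(K, K ⊗ G) ⟶ 𝓗om•(K ⊗ M, (K ⊗ G) ⊗ M)) ≫ 𝓗om•(K ⊗ M, λ•_G) ≫ Tr•_{K ⊗ M} = Tr•_K`. [cite: BuchweitzFlenner2003, §4] -/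
theorem twistApp_comp_map_lamG_comp_supertrace :
    twistApp c K (twistG X.left G K) ≫ map X.left ((prolong c).obj K) (lamG c G K) ≫
        supertrace X.left G ((prolong c).obj K) (isFiniteLocallyFree_prolong_X c K hK) =
      supertrace X.left G K hK := by
  refine HomologicalComplex.to_single_hom_ext ?_
  rw [HomologicalComplex.comp_f, HomologicalComplex.comp_f, supertrace, supertrace, HomologicalComplex.mkHomToSingle_f,
    HomologicalComplex.mkHomToSingle_f, twistApp_f, ← twistAppX_comp_map_lamG_comp_str₀ c G K hK]
  simp only [Category.assoc]

end Supertrace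

end HomComplex

end Summit.Ventures.HSemireg

end
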